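import Mathlib
import Summits.KontsevichZagierPeriods.KontsevichZagierPeriods.Theorems.SoloInformedDivisionMove
import Literature.NumberTheory.Transcendental.EllIterRep
import Literature.NumberTheory.Transcendental.KZDominatedFamilyRelations
import Literature.NumberTheory.Transcendental.KZLogCalculusProofs
import HarnessLib
import HarnessLib.Audit

/-!
# Division by translation IV: the second kind under the addition map (solo-informed, s43)

Fourth file of LEMMA XXIX.1 KERNEL.  Notation of parts I–II: `0 < m < 1`, `T_a` Jacobi's addition
map, `κ(x) = ((1−x²)(1−m x²))^{-1/2}`, `e(x) = (1 − m x²)κ(x)` (second kind), and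
`W_a(t) = √(1−T_a(t)²)√(1−m T_a(t)²)·κ(t)` — the derivative `T_a'` in its INVARIANT form
`T_a' = w(T_a)/w(t)` (`soloInformed_addmDeriv_eq`; this is the Jacobian identity of part I read
backwards).  Jacobi's addition theorem for the zeta function, differentiated, is the identity

  `e(T_a(t))·T_a'(t) = e(t) − m·a·(T_a(t) + t·T_a'(t)) = e(t) − m·a·(t·T_a(t))'`

(`soloInformed_addm_secondKind`; abstract polynomial form `soloInformed_addm_zeta_identity`):
`E(u+v) − E(v) = E(u) − k² sn u sn v sn(u+v)` in Legendre's notation.  The file also provides the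
semialgebraic bookkeeping for part V: `x ↦ T_a(x₀)` and `x ↦ W_a(x₀)` are `ℚ`-semialgebraic
functions, `W_a` is continuous on `[0,b]` (`b < 1`), and the representation
`P = [[0,b], m a (T_a + t W_a)]` of the correction term exists.

References: C. G. J. Jacobi, *Fundamenta nova* (1829), §§53–55 (addition theorem for `Z`);
A. M. Legendre, *Traité des fonctions elliptiques* I (1825), ch. IX; E. T. Whittaker,
G. N. Watson, *Modern Analysis*, §22.735; M. Kontsevich, D. Zagier, *Periods* (2001), §1.2;
this work (solo-informed s43).
-/

noncomputable section

open MeasureTheory Set Filter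
open scoped Classical

open Literature.NumberTheory.Transcendental Literature.NumberTheory.Transcendental.KZ
open Literature.ModelTheory.ExponentialFields

namespace Summit.KontsevichZagierPeriods.KontsevichZagierPeriods.Theorems

/-! ### Jacobi's `Z`-addition theorem, differentiated -/

/-- Abstract form of Jacobi's `Z`-addition theorem, differentiated:
`(d_a d_t − m a t c_a c_t)² = (1 − m t²)(1 − m a²t²)² − m a·(N·D·c_t d_t + t·g·h)` with
`N = t c_a d_a + a c_t d_t`, `D = 1 − m a²t²`, `g, h` the `cn`-, `dn`-numerators. [Jacobi 1829, §53] -/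
theorem soloInformed_addm_zeta_identity (m a t ca da ct dt : ℝ) (hB : da ^ 2 = 1 - m * a ^ 2)
    (hC : ct ^ 2 = 1 - t ^ 2) (hE : dt ^ 2 = 1 - m * t ^ 2) :
    (da * dt - m * a * t * (ca * ct)) ^ 2 =
      (1 - m * t ^ 2) * (1 - m * a ^ 2 * t ^ 2) ^ 2 -
        m * a * ((t * (ca * da) + a * (ct * dt)) * (1 - m * a ^ 2 * t ^ 2) * (ct * dt) +
          t * ((ca * ct - a * t * (da * dt)) * (da * dt - m * a * t * (ca * ct)))) := by
  linear_combination ((1 - m * a ^ 2 * t ^ 2) * dt ^ 2) * hB +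
    ((1 - m * a ^ 2 * t ^ 2) * m * a ^ 2 * dt ^ 2) * hC + (1 - m * a ^ 2 * t ^ 2) ^ 2 * hE

/-- **The second-kind integrand under translation** (Jacobi's `Z`-addition theorem,
differentiated): under the strict sign condition,
`e(T_a(t))·|T_a'(t)| = e(t) − m a·(T_a(t) + t·T_a'(t))`, `e(x) = (1 − m x²)κ(x)`. [Jacobi 1829, §53] -/
theorem soloInformed_addm_secondKind {m a t : ℝ} (hm : m ∈ Ioo (0:ℝ) 1) (ha : a ∈ Icc (0:ℝ) 1)
    (ht : t ∈ Ioo (0:ℝ) 1) (hs : t ^ 2 * (1 - m * a ^ 2) < 1 - a ^ 2) :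
    (1 - m * soloInformedAddm m a t ^ 2) *
        ((√(1 - soloInformedAddm m a t ^ 2))⁻¹ * (√(1 - m * soloInformedAddm m a t ^ 2))⁻¹) *
        |soloInformedAddmDeriv m a t| =
      (1 - m * t ^ 2) * ((√(1 - t ^ 2))⁻¹ * (√(1 - m * t ^ 2))⁻¹) -
        m * a * (soloInformedAddm m a t + t * soloInformedAddmDeriv m a t) := by
  have ht' : t ∈ Icc (0:ℝ) 1 := ⟨ht.1.le, ht.2.le⟩
  obtain ⟨hca, hda⟩ := soloInformed_addm_radicands hm ha
  have hct : 0 < 1 - t ^ 2 := by nlinarith [ht.1, ht.2]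
  have hdt : 0 < 1 - m * t ^ 2 := (soloInformed_addm_radicands hm ht').2
  have hD := soloInformed_addm_denom_pos hm ha ht'
  have hjac := soloInformed_addm_jacobian hm ha ht hs
  obtain ⟨h1, h2⟩ := soloInformed_addm_sqrt hm ha ht' hs.le
  have hg := (soloInformed_addm_sign_iff hm ha ht').2 hs
  have hh := soloInformed_addm_dn_pos hm ha ht'
  -- replace `κ(T)|T'|` by `κ(t)` and `1 − m T²` by `(h/D)²`
  have hmT : 1 - m * soloInformedAddm m a t ^ 2 =
      ((√(1 - m * a ^ 2) * √(1 - m * t ^ 2) - m * a * t * (√(1 - a ^ 2) * √(1 - t ^ 2))) /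
        (1 - m * a ^ 2 * t ^ 2)) ^ 2 := by
    rw [← h2, Real.sq_sqrt]
    have hT0 := soloInformed_addm_nonneg hm ha ht'
    have hT1 := (soloInformed_addm_lt_one hm ha ht').1
    nlinarith [mul_nonneg hm.1.le (sub_nonneg.2 hT1),
      mul_nonneg hT0 (mul_nonneg hm.1.le (sub_nonneg.2 hT1)), hm.2]
  rw [mul_assoc, ← hjac, hmT, soloInformedAddm, soloInformedAddmDeriv]
  set ca := √(1 - a ^ 2) with hca'
  set da := √(1 - m * a ^ 2) with hda'
  set ct := √(1 - t ^ 2) with hct'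
  set dt := √(1 - m * t ^ 2) with hdt'
  have hCt : ct ≠ 0 := (Real.sqrt_pos.2 hct).ne'
  have hDt : dt ≠ 0 := (Real.sqrt_pos.2 hdt).ne'
  have key := soloInformed_addm_zeta_identity m a t ca da ct dt (Real.sq_sqrt hda.le)
    (Real.sq_sqrt hct.le) (Real.sq_sqrt hdt.le)
  set D := 1 - m * a ^ 2 * t ^ 2 with hD'
  have hD0 : D ≠ 0 := hD.ne'
  have e1 : ((da * dt - m * a * t * (ca * ct)) / D) ^ 2 * (ct⁻¹ * dt⁻¹) =
      (da * dt - m * a * t * (ca * ct)) ^ 2 / (D ^ 2 * (ct * dt)) := by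
    rw [div_pow, ← mul_inv, ← div_eq_mul_inv, div_div]
  rw [e1, key]
  field_simp

/-! ### The derivative in invariant form -/

/-- The invariant form of the derivative of the addition map:
`W_a(t) = √(1−T_a(t)²)·√(1−m T_a(t)²)·κ(t)` (`= cn(u+v) dn(u+v)/(cn u dn u)`). [this work] -/
def soloInformedAddmW (m a t : ℝ) : ℝ :=
  √(1 - soloInformedAddm m a t ^ 2) * √(1 - m * soloInformedAddm m a t ^ 2) *
    ((√(1 - t ^ 2))⁻¹ * (√(1 - m * t ^ 2))⁻¹)

/-- **`T_a' = W_a`** on `[0,1)` under the (non-strict) sign condition: the Jacobian identity read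
backwards. [Jacobi 1829, §18] -/
theorem soloInformed_addmDeriv_eq {m a t : ℝ} (hm : m ∈ Ioo (0:ℝ) 1) (ha : a ∈ Icc (0:ℝ) 1)
    (ht : t ∈ Ico (0:ℝ) 1) (hs : t ^ 2 * (1 - m * a ^ 2) ≤ 1 - a ^ 2) :
    soloInformedAddmDeriv m a t = soloInformedAddmW m a t := by
  have ht' : t ∈ Icc (0:ℝ) 1 := ⟨ht.1, ht.2.le⟩
  obtain ⟨h1, h2⟩ := soloInformed_addm_sqrt hm ha ht' hs
  have hct : 0 < 1 - t ^ 2 := by nlinarith [ht.1, ht.2]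
  have hdt : 0 < 1 - m * t ^ 2 := (soloInformed_addm_radicands hm ht').2
  have hD := soloInformed_addm_denom_pos hm ha ht'
  rw [soloInformedAddmW, h1, h2, soloInformedAddmDeriv]
  set g := √(1 - a ^ 2) * √(1 - t ^ 2) - a * t * (√(1 - m * a ^ 2) * √(1 - m * t ^ 2)) with hg'
  set h := √(1 - m * a ^ 2) * √(1 - m * t ^ 2) - m * a * t * (√(1 - a ^ 2) * √(1 - t ^ 2)) with hh'
  set D := 1 - m * a ^ 2 * t ^ 2 with hD'
  set ct := √(1 - t ^ 2) with hct'
  set dt := √(1 - m * t ^ 2) with hdt'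
  have hD0 : D ≠ 0 := hD.ne'
  have hct0 : ct ≠ 0 := (Real.sqrt_pos.2 hct).ne'
  have hdt0 : dt ≠ 0 := (Real.sqrt_pos.2 hdt).ne'
  rw [div_mul_div_comm, div_mul_eq_mul_div, div_eq_div_iff (mul_ne_zero (pow_ne_zero 2 hD0)
    (mul_ne_zero hct0 hdt0)) (mul_ne_zero hD0 hD0)]
  calc g * h * (D * D) = g * h * D ^ 2 * ((ct⁻¹ * ct) * (dt⁻¹ * dt)) := by
        rw [inv_mul_cancel₀ hct0, inv_mul_cancel₀ hdt0]; ring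
    _ = g * h * (ct⁻¹ * dt⁻¹) * (D ^ 2 * (ct * dt)) := by ring

/-! ### Semialgebraic bookkeeping -/

/-- The closed slab `{x | 0 ≤ x₀ ≤ b}` (`b` algebraic) is `ℚ`-semialgebraic. [BCR 1998, §2.2] -/
theorem soloInformed_closedSlab_isSemialgebraic {b : ℝ} (hba : IsAlgebraic ℚ b) :
    IsSemialgebraic ℚ {x : Fin 1 → ℝ | x 0 ∈ Icc (0:ℝ) b} := by
  have e : {x : Fin 1 → ℝ | x 0 ∈ Icc (0:ℝ) b} =
      {x : Fin 1 → ℝ | x 0 < 0}ᶜ ∩ {x : Fin 1 → ℝ | b < x 0}ᶜ := by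
    ext x; simp only [mem_setOf_eq, mem_Icc, mem_inter_iff, mem_compl_iff, not_lt]
  rw [e]
  exact (isSemialgebraic_setOf_apply_lt_const isAlgebraic_zero 0).compl.inter
    (isSemialgebraic_setOf_const_lt_apply hba 0).compl

/-- `x ↦ T_a(x₀)` is a `ℚ`-semialgebraic function on every `ℚ`-semialgebraic
`S ⊆ {0 ≤ x₀ ≤ 1}` (`m`, `a` algebraic). [BCR 1998, Prop. 2.2.6] -/
theorem soloInformed_addm_fun_sa {m a : ℝ} (hm : m ∈ Ioo (0:ℝ) 1) (hma : IsAlgebraic ℚ m)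
    (ha : a ∈ Icc (0:ℝ) 1) (haa : IsAlgebraic ℚ a) {S : Set (Fin 1 → ℝ)}
    (hS : IsSemialgebraic ℚ S) (hS1 : ∀ x ∈ S, x 0 ∈ Icc (0:ℝ) 1) :
    IsSemialgebraicFunOn ℚ S (fun x : Fin 1 → ℝ => soloInformedAddm m a (x 0)) := by
  obtain ⟨h1, h2, h3⟩ := soloInformed_addm_pieces_sa hma haa hS
  have hc := soloInformed_addm_const_isAlgebraic hm hma ha haa
  have hX : IsSemialgebraicFunOn ℚ S (fun x : Fin 1 → ℝ => x 0) :=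
    (isSemialgebraicFunOn_aeval hS (MvPolynomial.X 0)).congr fun x _ => by
      simp only [MvPolynomial.aeval_X]
  refine (((hX.mul_holds (isSemialgebraicFunOn_const_of_isAlgebraic hS hc)).add_holds
    ((isSemialgebraicFunOn_const_of_isAlgebraic hS haa).mul_holds
      ((IsSemialgebraicFunOn.sqrt_holds h1).mul_holds (IsSemialgebraicFunOn.sqrt_holds h2)))).div
    h3 fun x hx => (soloInformed_addm_denom_pos hm ha (hS1 x hx)).ne').congr fun x _ => ?_
  simp only [Pi.add_apply, Pi.mul_apply, soloInformedAddm]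

/-- `x ↦ W_a(x₀)` is a `ℚ`-semialgebraic function on every `ℚ`-semialgebraic
`S ⊆ {0 ≤ x₀ < 1}`. [BCR 1998, Prop. 2.2.6] -/
theorem soloInformed_addmW_sa {m a : ℝ} (hm : m ∈ Ioo (0:ℝ) 1) (hma : IsAlgebraic ℚ m)
    (ha : a ∈ Icc (0:ℝ) 1) (haa : IsAlgebraic ℚ a) {S : Set (Fin 1 → ℝ)}
    (hS : IsSemialgebraic ℚ S) (hS1 : ∀ x ∈ S, x 0 ∈ Ico (0:ℝ) 1) :
    IsSemialgebraicFunOn ℚ S (fun x : Fin 1 → ℝ => soloInformedAddmW m a (x 0)) := by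
  obtain ⟨h1, h2, -⟩ := soloInformed_addm_pieces_sa hma haa hS
  have hT := soloInformed_addm_fun_sa hm hma ha haa hS fun x hx => ⟨(hS1 x hx).1, (hS1 x hx).2.le⟩
  have u1 : IsSemialgebraicFunOn ℚ S (fun x : Fin 1 → ℝ => 1 - soloInformedAddm m a (x 0) ^ 2) :=
    ((isSemialgebraicFunOn_const_of_isAlgebraic hS isAlgebraic_one).sub_holds
      (hT.mul_holds hT)).congr fun x _ => by simp only [Pi.sub_apply, Pi.mul_apply, sq]
  have u2 : IsSemialgebraicFunOn ℚ S
      (fun x : Fin 1 → ℝ => 1 - m * soloInformedAddm m a (x 0) ^ 2) :=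
    ((isSemialgebraicFunOn_const_of_isAlgebraic hS isAlgebraic_one).sub_holds
      ((isSemialgebraicFunOn_const_of_isAlgebraic hS hma).mul_holds (hT.mul_holds hT))).congr
      fun x _ => by simp only [Pi.sub_apply, Pi.mul_apply, sq]
  have hpos : ∀ x ∈ S, 0 < 1 - x 0 ^ 2 ∧ 0 < 1 - m * x 0 ^ 2 := fun x hx =>
    ⟨soloInformed_addm_radicand_pos (hS1 x hx),
      (soloInformed_addm_radicands hm ⟨(hS1 x hx).1, (hS1 x hx).2.le⟩).2⟩
  refine (((IsSemialgebraicFunOn.sqrt_holds u1).mul_holds (IsSemialgebraicFunOn.sqrt_holds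
    u2)).mul_holds (((IsSemialgebraicFunOn.sqrt_holds h1).inv fun x hx =>
      (Real.sqrt_pos.2 (hpos x hx).1).ne').mul_holds ((IsSemialgebraicFunOn.sqrt_holds h2).inv
        fun x hx => (Real.sqrt_pos.2 (hpos x hx).2).ne'))).congr fun x _ => ?_
  simp only [Pi.mul_apply, soloInformedAddmW]

/-- `W_a` is continuous on `[0,b]` for `b < 1`. [folklore] -/
theorem soloInformed_addmW_continuousOn {m a b : ℝ} (hm : m ∈ Ioo (0:ℝ) 1) (ha : a ∈ Icc (0:ℝ) 1)
    (hb : b ∈ Ioo (0:ℝ) 1) : ContinuousOn (soloInformedAddmW m a) (Icc (0:ℝ) b) := by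
  have hTc := (soloInformed_addm_continuousOn hm ha).mono (Icc_subset_Icc_right hb.2.le)
  have hpos : ∀ t ∈ Icc (0:ℝ) b, 0 < 1 - t ^ 2 ∧ 0 < 1 - m * t ^ 2 := fun t ht =>
    ⟨soloInformed_addm_radicand_pos ⟨ht.1, ht.2.trans_lt hb.2⟩,
      (soloInformed_addm_radicands hm ⟨ht.1, ht.2.trans hb.2.le⟩).2⟩
  have e : soloInformedAddmW m a = fun t => √(1 - soloInformedAddm m a t ^ 2) *
      √(1 - m * soloInformedAddm m a t ^ 2) * ((√(1 - t ^ 2))⁻¹ * (√(1 - m * t ^ 2))⁻¹) := rfl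
  rw [e]
  have hU : Continuous fun t : ℝ => √(1 - t ^ 2) := by fun_prop
  have hV : Continuous fun t : ℝ => √(1 - m * t ^ 2) := by fun_prop
  exact ((continuousOn_const.sub (hTc.pow 2)).sqrt.mul
    (continuousOn_const.sub (continuousOn_const.mul (hTc.pow 2))).sqrt).mul
    ((hU.continuousOn.inv₀ fun t ht => (Real.sqrt_pos.2 (hpos t ht).1).ne').mul
      (hV.continuousOn.inv₀ fun t ht => (Real.sqrt_pos.2 (hpos t ht).2).ne'))

/-- **The correction representation `P = [[0,b], m a (T_a + t·W_a)]`** (`= [[0,b], m a (t T_a)']`)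
exists: a continuous semialgebraic integrand on a compact slab. [this work] -/
theorem soloInformed_exists_addmP_rep {m a b : ℝ} (hm : m ∈ Ioo (0:ℝ) 1) (hma : IsAlgebraic ℚ m)
    (ha : a ∈ Icc (0:ℝ) 1) (haa : IsAlgebraic ℚ a) (hb : b ∈ Ioo (0:ℝ) 1) (hba : IsAlgebraic ℚ b) :
    ∃ P : IntegralRep 1, P.domain = {x | x 0 ∈ Icc (0:ℝ) b} ∧
      ∀ x, P.integrand x =
        m * a * (soloInformedAddm m a (x 0) + x 0 * soloInformedAddmW m a (x 0)) := by
  have hC := soloInformed_closedSlab_isSemialgebraic hba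
  have hT := soloInformed_addm_fun_sa hm hma ha haa hC fun x hx => ⟨hx.1, hx.2.trans hb.2.le⟩
  have hW := soloInformed_addmW_sa hm hma ha haa hC fun x hx => ⟨hx.1, hx.2.trans_lt hb.2⟩
  have hX : IsSemialgebraicFunOn ℚ {x : Fin 1 → ℝ | x 0 ∈ Icc (0:ℝ) b} (fun x : Fin 1 → ℝ => x 0) :=
    (isSemialgebraicFunOn_aeval hC (MvPolynomial.X 0)).congr fun x _ => by
      simp only [MvPolynomial.aeval_X]
  have hsa : IsSemialgebraicFunOn ℚ {x : Fin 1 → ℝ | x 0 ∈ Icc (0:ℝ) b} (fun x : Fin 1 → ℝ =>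
      m * a * (soloInformedAddm m a (x 0) + x 0 * soloInformedAddmW m a (x 0))) :=
    ((isSemialgebraicFunOn_const_of_isAlgebraic hC (hma.mul haa)).mul_holds
      (hT.add_holds (hX.mul_holds hW))).congr fun x _ => by
        simp only [Pi.mul_apply, Pi.add_apply]
  have hcont : ContinuousOn (fun t : ℝ =>
      m * a * (soloInformedAddm m a t + t * soloInformedAddmW m a t)) (Icc 0 b) :=
    continuousOn_const.mul (((soloInformed_addm_continuousOn hm ha).mono
      (Icc_subset_Icc_right hb.2.le)).add
      (continuousOn_id.mul (soloInformed_addmW_continuousOn hm ha hb)))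
  have hK : IsCompact (Set.pi univ fun _ : Fin 1 => Icc (0:ℝ) b) :=
    isCompact_univ_pi fun _ => isCompact_Icc
  refine ⟨⟨_, _, hC, hsa, ?_⟩, rfl, fun _ => rfl⟩
  refine ((hcont.comp (continuous_apply 0).continuousOn fun x hx => (mem_univ_pi.mp hx) 0)
    |>.integrableOn_compact hK).mono_set fun x hx => ?_
  exact mem_univ_pi.mpr fun i => by rw [Subsingleton.elim i 0]; exact hx

end Summit.KontsevichZagierPeriods.KontsevichZagierPeriods.Theorems

end
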